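import Summits.AtomisticToContinuum.Crystallization.Theorems.ChartedZeroExcessLayeredLatticeLiouvilleZZZYRC

/-!
# Charted zero-excess layered-lattice Liouville — ZZZYRCN: (NL♯) `NullLagrangianP` PROVED

Cell `decomp-a2c`, lens 2 «structural dichotomy (special | generic)», generation 98.  D⁗ «FullRangeClusterCertificate» (ZZZYRC) glues
`(RI♯) ∧ (K♯) ∧ (NL♯) ∧ (TL♯) ∧ (PF♯) ∧ (JF♯) ∧ (CZ♯) ⇒ (U♯)`; its GENERIC piece (NL♯) `NullLagrangianP` — the plaquette forms of the discrete
null Lagrangian telescope to zero for every per-layer shift `d`, all coefficient tables `(Cpar, Cperp)` and every finitely supported `φ` — is a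
word-free, potential-free, geometry-free identity.  This file PROVES it (`nullLagrangianP : NullLagrangianP`) and feeds it to the glue:
`uniformEquilStabilityAt_of_clusterCertificateFull'` = D⁗ with one hypothesis fewer (+ the record instance at the GO-edition-2 constants).

PROOF.  For the plaquette family `(a, b)` write `S_a = stepIdx d a`, `C_p = plaqCoef Cpar Cperp x a b` (`p = (x, a, b)`), `Φ y = φ y.1 y.2`.
Expanding the two inner products of `nullTerm` bilinearly gives eight pairing terms
`f₁ = ⟪Φ(S_a x), C_p Φ(S_b S_a x)⟫, f₂ = ⟪Φ(S_a x), C_p Φ(S_a x)⟫, f₃ = ⟪Φ x, C_p Φ(S_b S_a x)⟫, f₄ = ⟪Φ x, C_p Φ(S_a x)⟫` and `g₁ … g₄` (swap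
`a ↔ b` in the steps, not in `C_p`), `nullTerm = (f₁ − f₂ − f₃ + f₄) − (g₁ − g₂ − g₃ + g₄)`.  The three steps are COMMUTING BIJECTIONS of
`Cell 2 × ℤ` (`stepIdx_comm`, `stepIdx_bijective`) and the coefficient is invariant under both steps of its family (`plaqCoef_stepIdx_left/right`:
in-plane families see only the layer, which in-plane steps preserve; families through the layer step have constant coefficients).  Re-indexing
the finitely supported sums along `p ↦ (S_a x, a, b)` resp. `p ↦ (S_b x, a, b)` (`finsum_eq_of_bijective`) gives `Σ f₁ = Σ g₄`, `Σ f₂ = Σ h = Σ g₂`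
(`h = ⟪Φ x, C_p Φ x⟫`), `Σ g₁ = Σ f₄`, and `f₃ = g₃` pointwise by commutation; everything cancels.  All sums are finite because every pairing
term has `Φ` at `x`, `S_a x` or `S_b x` as its left factor (`finite_support_of_step`, `finite_support_of_id`).

Def-free (11 theorems + 1 record example); imports ZZZYRC only; no instance / notation / option; 0 sorry. [g98]
-/

open scoped BigOperators InnerProductSpace RealInnerProductSpace

namespace Summit.AtomisticToContinuum.Crystallization.Theorems.ChartedZeroExcessLayeredLatticeLiouville

open Summit.AtomisticToContinuum.Crystallization.Theorems.ChartedPlanarOrderRigidityDoor (E3)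

/-- `Fin 3` exhaustion in the form used below. [g98] -/
theorem fin3_cases : ∀ a : Fin 3, a = 0 ∨ a = 1 ∨ a = 2 := by decide

section Steps

variable (d : ℤ → Cell 2)

/-- the three index steps, evaluated. [g98] -/
theorem stepIdx_apply (x : Cell 2 × ℤ) :
    stepIdx d 0 x = (x.1 + Pi.single 0 1, x.2) ∧ stepIdx d 1 x = (x.1 + Pi.single 1 1, x.2) ∧ stepIdx d 2 x = (x.1 + d x.2, x.2 + 1) := by
  refine ⟨?_, ?_, ?_⟩
  · simp [stepIdx]
  · rw [stepIdx, if_neg (by decide), if_pos rfl]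
  · rw [stepIdx, if_neg (by decide), if_neg (by decide)]

/-- THE STEPS COMMUTE (the in-plane shift of the layer step depends on the layer only, which in-plane steps preserve). [g98] -/
theorem stepIdx_comm (a b : Fin 3) (x : Cell 2 × ℤ) : stepIdx d a (stepIdx d b x) = stepIdx d b (stepIdx d a x) := by
  obtain ⟨h0, h1, h2⟩ := stepIdx_apply d x
  rcases fin3_cases a with rfl | rfl | rfl <;> rcases fin3_cases b with rfl | rfl | rfl <;>
    first
    | rfl
    | (simp only [h0, h1, h2, (stepIdx_apply d _).1, (stepIdx_apply d _).2.1, (stepIdx_apply d _).2.2, Prod.mk.injEq, and_true]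
       abel)

/-- EACH STEP IS A BIJECTION of `Cell 2 × ℤ`. [g98] -/
theorem stepIdx_bijective (a : Fin 3) : Function.Bijective (stepIdx d a) := by
  rcases fin3_cases a with rfl | rfl | rfl
  · refine Function.bijective_iff_has_inverse.mpr ⟨fun x => (x.1 - Pi.single 0 1, x.2), fun x => ?_, fun x => ?_⟩
    · simp [(stepIdx_apply d x).1]
    · simp [(stepIdx_apply d (x.1 - Pi.single 0 1, x.2)).1]
  · refine Function.bijective_iff_has_inverse.mpr ⟨fun x => (x.1 - Pi.single 1 1, x.2), fun x => ?_, fun x => ?_⟩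
    · simp [(stepIdx_apply d x).2.1]
    · simp [(stepIdx_apply d (x.1 - Pi.single 1 1, x.2)).2.1]
  · refine Function.bijective_iff_has_inverse.mpr ⟨fun x => (x.1 - d (x.2 - 1), x.2 - 1), fun x => ?_, fun x => ?_⟩
    · simp [(stepIdx_apply d x).2.2]
    · simp [(stepIdx_apply d (x.1 - d (x.2 - 1), x.2 - 1)).2.2]

/-- the step lifted to plaquette labels `p = (x, a, b) ↦ (S_{c(a,b)} x, a, b)` is a bijection. [g98] -/
theorem liftStep_bijective (c : Fin 3 × Fin 3 → Fin 3) :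
    Function.Bijective (fun p : (Cell 2 × ℤ) × Fin 3 × Fin 3 => (stepIdx d (c p.2) p.1, p.2)) := by
  constructor
  · rintro ⟨x, ab⟩ ⟨y, ab'⟩ h
    simp only [Prod.mk.injEq] at h
    obtain ⟨h1, h2⟩ := h
    subst h2
    exact Prod.ext ((stepIdx_bijective d (c ab)).1 h1) rfl
  · rintro ⟨y, ab⟩
    obtain ⟨x, hx⟩ := (stepIdx_bijective d (c ab)).2 y
    exact ⟨(x, ab), by simp [hx]⟩

/-- in-plane steps preserve the layer. [g98] -/
theorem stepIdx_snd_of_ne_two {a : Fin 3} (ha : a ≠ 2) (x : Cell 2 × ℤ) : (stepIdx d a x).2 = x.2 := by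
  rcases fin3_cases a with rfl | rfl | rfl
  · rw [(stepIdx_apply d x).1]
  · rw [(stepIdx_apply d x).2.1]
  · exact absurd rfl ha

/-- THE PLAQUETTE COEFFICIENT IS INVARIANT UNDER BOTH STEPS OF ITS FAMILY. [g98] -/
theorem plaqCoef_stepIdx (Cpar : ℤ → Fin 3 → Fin 3 → (E3 →L[ℝ] E3)) (Cperp : Fin 3 → Fin 3 → (E3 →L[ℝ] E3)) (a b : Fin 3)
    (x : Cell 2 × ℤ) :
    plaqCoef Cpar Cperp (stepIdx d a x) a b = plaqCoef Cpar Cperp x a b ∧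
      plaqCoef Cpar Cperp (stepIdx d b x) a b = plaqCoef Cpar Cperp x a b := by
  unfold plaqCoef
  by_cases h : a = 2 ∨ b = 2
  · simp only [if_pos h, and_self]
  · have ha : a ≠ 2 := fun h' => h (Or.inl h')
    have hb : b ≠ 2 := fun h' => h (Or.inr h')
    simp only [if_neg h, stepIdx_snd_of_ne_two d ha, stepIdx_snd_of_ne_two d hb, and_self]

/-- a plaquette functional whose value vanishes wherever `φ` vanishes at the stepped site `S_{c(a,b)} x` has finite support. [g98] -/
theorem finite_support_of_step {φ : Cell 2 → ℤ → E3} (hφ : HasFiniteSupport φ) (c : Fin 3 × Fin 3 → Fin 3)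
    (F : (Cell 2 × ℤ) × Fin 3 × Fin 3 → ℝ)
    (hF : ∀ p, φ (stepIdx d (c p.2) p.1).1 (stepIdx d (c p.2) p.1).2 = 0 → F p = 0) : (Function.support F).Finite := by
  obtain ⟨s, hs⟩ := hφ
  have hfin : ((fun p : (Cell 2 × ℤ) × Fin 3 × Fin 3 => (stepIdx d (c p.2) p.1, p.2)) ⁻¹'
      ((↑s : Set (Cell 2 × ℤ)) ×ˢ (Set.univ : Set (Fin 3 × Fin 3)))).Finite :=
    (s.finite_toSet.prod Set.finite_univ).preimage (liftStep_bijective d c).1.injOn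
  refine hfin.subset fun p hp => ?_
  simp only [Set.mem_preimage, Set.mem_prod, Set.mem_univ, and_true, Finset.mem_coe]
  by_contra hns
  exact hp (hF p (hs _ _ hns))

/-- a plaquette functional whose value vanishes wherever `φ` vanishes at the base site `x` has finite support. [g98] -/
theorem finite_support_of_id {φ : Cell 2 → ℤ → E3} (hφ : HasFiniteSupport φ) (F : (Cell 2 × ℤ) × Fin 3 × Fin 3 → ℝ)
    (hF : ∀ p, φ p.1.1 p.1.2 = 0 → F p = 0) : (Function.support F).Finite := by
  obtain ⟨s, hs⟩ := hφ
  refine (s.finite_toSet.prod (Set.finite_univ : (Set.univ : Set (Fin 3 × Fin 3)).Finite)).subset fun p hp => ?_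
  simp only [Set.mem_prod, Set.mem_univ, and_true, Finset.mem_coe]
  by_contra hns
  exact hp (hF p (hs _ _ hns))

end Steps

/-- ★ **(NL♯) PROVED: `NullLagrangianP`** — the discrete null Lagrangian vanishes identically on finitely supported fields. [g98] -/
theorem nullLagrangianP : NullLagrangianP := by
  intro d Cpar Cperp φ hφ
  classical
  -- the eight pairing terms and the diagonal term
  let Φ : Cell 2 × ℤ → E3 := fun y => φ y.1 y.2
  let S : Fin 3 → Cell 2 × ℤ → Cell 2 × ℤ := fun a => stepIdx d a
  let C : (Cell 2 × ℤ) × Fin 3 × Fin 3 → (E3 →L[ℝ] E3) := fun p => plaqCoef Cpar Cperp p.1 p.2.1 p.2.2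
  let f₁ : (Cell 2 × ℤ) × Fin 3 × Fin 3 → ℝ := fun p => ⟪Φ (S p.2.1 p.1), C p (Φ (S p.2.2 (S p.2.1 p.1)))⟫
  let f₂ : (Cell 2 × ℤ) × Fin 3 × Fin 3 → ℝ := fun p => ⟪Φ (S p.2.1 p.1), C p (Φ (S p.2.1 p.1))⟫
  let f₃ : (Cell 2 × ℤ) × Fin 3 × Fin 3 → ℝ := fun p => ⟪Φ p.1, C p (Φ (S p.2.2 (S p.2.1 p.1)))⟫
  let f₄ : (Cell 2 × ℤ) × Fin 3 × Fin 3 → ℝ := fun p => ⟪Φ p.1, C p (Φ (S p.2.1 p.1))⟫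
  let g₁ : (Cell 2 × ℤ) × Fin 3 × Fin 3 → ℝ := fun p => ⟪Φ (S p.2.2 p.1), C p (Φ (S p.2.1 (S p.2.2 p.1)))⟫
  let g₂ : (Cell 2 × ℤ) × Fin 3 × Fin 3 → ℝ := fun p => ⟪Φ (S p.2.2 p.1), C p (Φ (S p.2.2 p.1))⟫
  let g₃ : (Cell 2 × ℤ) × Fin 3 × Fin 3 → ℝ := fun p => ⟪Φ p.1, C p (Φ (S p.2.1 (S p.2.2 p.1)))⟫
  let g₄ : (Cell 2 × ℤ) × Fin 3 × Fin 3 → ℝ := fun p => ⟪Φ p.1, C p (Φ (S p.2.2 p.1))⟫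
  let h : (Cell 2 × ℤ) × Fin 3 × Fin 3 → ℝ := fun p => ⟪Φ p.1, C p (Φ p.1)⟫
  have hterm : ∀ p, nullTerm d Cpar Cperp φ p = (f₁ p - f₂ p - f₃ p + f₄ p) - (g₁ p - g₂ p - g₃ p + g₄ p) := by
    intro p
    simp only [nullTerm, f₁, f₂, f₃, f₄, g₁, g₂, g₃, g₄, Φ, S, C, inner_sub_left, inner_sub_right, map_sub]
    ring
  -- finite supports
  have hf₁ : (Function.support f₁).Finite :=
    finite_support_of_step d hφ (fun ab => ab.1) f₁ fun p hp => by simp only [f₁, Φ, S, hp, inner_zero_left]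
  have hf₂ : (Function.support f₂).Finite :=
    finite_support_of_step d hφ (fun ab => ab.1) f₂ fun p hp => by simp only [f₂, Φ, S, hp, inner_zero_left]
  have hg₁ : (Function.support g₁).Finite :=
    finite_support_of_step d hφ (fun ab => ab.2) g₁ fun p hp => by simp only [g₁, Φ, S, hp, inner_zero_left]
  have hg₂ : (Function.support g₂).Finite :=
    finite_support_of_step d hφ (fun ab => ab.2) g₂ fun p hp => by simp only [g₂, Φ, S, hp, inner_zero_left]
  have hf₃ : (Function.support f₃).Finite := finite_support_of_id hφ f₃ fun p hp => by simp only [f₃, Φ, hp, inner_zero_left]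
  have hf₄ : (Function.support f₄).Finite := finite_support_of_id hφ f₄ fun p hp => by simp only [f₄, Φ, hp, inner_zero_left]
  have hg₃ : (Function.support g₃).Finite := finite_support_of_id hφ g₃ fun p hp => by simp only [g₃, Φ, hp, inner_zero_left]
  have hg₄ : (Function.support g₄).Finite := finite_support_of_id hφ g₄ fun p hp => by simp only [g₄, Φ, hp, inner_zero_left]
  -- one common finite index set
  let P₀ : Finset ((Cell 2 × ℤ) × Fin 3 × Fin 3) :=
    (((hf₁.union hf₂).union (hf₃.union hf₄)).union ((hg₁.union hg₂).union (hg₃.union hg₄))).toFinset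
  have mem : ∀ {F : (Cell 2 × ℤ) × Fin 3 × Fin 3 → ℝ},
      (∀ p, f₁ p = 0 → f₂ p = 0 → f₃ p = 0 → f₄ p = 0 → g₁ p = 0 → g₂ p = 0 → g₃ p = 0 → g₄ p = 0 → F p = 0) →
        Function.support F ⊆ ↑P₀ := by
    intro F hF p hp
    simp only [P₀, Set.Finite.coe_toFinset, Set.mem_union, Function.mem_support]
    by_contra hn
    simp only [not_or, ne_eq, not_not] at hn
    obtain ⟨⟨⟨h1, h2⟩, h3, h4⟩, ⟨h5, h6⟩, h7, h8⟩ := hn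
    exact hp (hF p h1 h2 h3 h4 h5 h6 h7 h8)
  have eT : nullTotal d Cpar Cperp φ = ∑ p ∈ P₀, nullTerm d Cpar Cperp φ p :=
    finsum_eq_sum_of_support_subset _ (mem fun p h1 h2 h3 h4 h5 h6 h7 h8 => by rw [hterm p, h1, h2, h3, h4, h5, h6, h7, h8]; ring)
  have e₁ : ∑ᶠ p, f₁ p = ∑ p ∈ P₀, f₁ p := finsum_eq_sum_of_support_subset _ (mem fun p h1 _ _ _ _ _ _ _ => h1)
  have e₂ : ∑ᶠ p, f₂ p = ∑ p ∈ P₀, f₂ p := finsum_eq_sum_of_support_subset _ (mem fun p _ h2 _ _ _ _ _ _ => h2)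
  have e₃ : ∑ᶠ p, f₃ p = ∑ p ∈ P₀, f₃ p := finsum_eq_sum_of_support_subset _ (mem fun p _ _ h3 _ _ _ _ _ => h3)
  have e₄ : ∑ᶠ p, f₄ p = ∑ p ∈ P₀, f₄ p := finsum_eq_sum_of_support_subset _ (mem fun p _ _ _ h4 _ _ _ _ => h4)
  have e₅ : ∑ᶠ p, g₁ p = ∑ p ∈ P₀, g₁ p := finsum_eq_sum_of_support_subset _ (mem fun p _ _ _ _ h5 _ _ _ => h5)
  have e₆ : ∑ᶠ p, g₂ p = ∑ p ∈ P₀, g₂ p := finsum_eq_sum_of_support_subset _ (mem fun p _ _ _ _ _ h6 _ _ => h6)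
  have e₇ : ∑ᶠ p, g₃ p = ∑ p ∈ P₀, g₃ p := finsum_eq_sum_of_support_subset _ (mem fun p _ _ _ _ _ _ h7 _ => h7)
  have e₈ : ∑ᶠ p, g₄ p = ∑ p ∈ P₀, g₄ p := finsum_eq_sum_of_support_subset _ (mem fun p _ _ _ _ _ _ _ h8 => h8)
  have eSum : ∑ p ∈ P₀, nullTerm d Cpar Cperp φ p =
      (∑ᶠ p, f₁ p - ∑ᶠ p, f₂ p - ∑ᶠ p, f₃ p + ∑ᶠ p, f₄ p) - (∑ᶠ p, g₁ p - ∑ᶠ p, g₂ p - ∑ᶠ p, g₃ p + ∑ᶠ p, g₄ p) := by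
    rw [e₁, e₂, e₃, e₄, e₅, e₆, e₇, e₈, Finset.sum_congr rfl fun p _ => hterm p]
    simp only [Finset.sum_sub_distrib, Finset.sum_add_distrib]
  -- re-indexing along the steps
  have cinv : ∀ (a b : Fin 3) (x : Cell 2 × ℤ), plaqCoef Cpar Cperp (stepIdx d a x) a b = plaqCoef Cpar Cperp x a b ∧
      plaqCoef Cpar Cperp (stepIdx d b x) a b = plaqCoef Cpar Cperp x a b := plaqCoef_stepIdx d Cpar Cperp
  have r₁ : ∑ᶠ p, f₁ p = ∑ᶠ p, g₄ p :=
    finsum_eq_of_bijective (fun p => (stepIdx d p.2.1 p.1, p.2)) (liftStep_bijective d fun ab => ab.1) fun p => by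
      simp only [f₁, g₄, Φ, S, C, (cinv p.2.1 p.2.2 p.1).1]
  have r₂ : ∑ᶠ p, f₂ p = ∑ᶠ p, h p :=
    finsum_eq_of_bijective (fun p => (stepIdx d p.2.1 p.1, p.2)) (liftStep_bijective d fun ab => ab.1) fun p => by
      simp only [f₂, h, Φ, S, C, (cinv p.2.1 p.2.2 p.1).1]
  have r₃ : ∑ᶠ p, g₂ p = ∑ᶠ p, h p :=
    finsum_eq_of_bijective (fun p => (stepIdx d p.2.2 p.1, p.2)) (liftStep_bijective d fun ab => ab.2) fun p => by
      simp only [g₂, h, Φ, S, C, (cinv p.2.1 p.2.2 p.1).2]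
  have r₄ : ∑ᶠ p, g₁ p = ∑ᶠ p, f₄ p :=
    finsum_eq_of_bijective (fun p => (stepIdx d p.2.2 p.1, p.2)) (liftStep_bijective d fun ab => ab.2) fun p => by
      simp only [g₁, f₄, Φ, S, C, (cinv p.2.1 p.2.2 p.1).2]
  have r₅ : ∑ᶠ p, f₃ p = ∑ᶠ p, g₃ p := finsum_congr fun p => by
    simp only [f₃, g₃, Φ, S, stepIdx_comm d p.2.2 p.2.1 p.1]
  rw [eT, eSum, r₁, r₂, r₃, r₄, r₅]
  ring

/-- ★ D⁗'s GLUE WITH (NL♯) DISCHARGED: `(RI♯) ∧ (K♯) ∧ (TL♯) ∧ (PF♯) ∧ (JF♯) ∧ (CZ♯) ⇒ (U♯)` — `uniformEquilStabilityAt_of_clusterCertificateFull`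
fed `nullLagrangianP`. [g98] -/
theorem uniformEquilStabilityAt_of_clusterCertificateFull' {s Λ c₀ ℓ₀ r₁ ϱ R cK cZ τ κ₁ κ₀ γT : ℝ} (h0 : 0 ≤ κ₁) (hκ : κ₀ ≤ κ₁ * cZ - γT)
    (hRI : UniformReindexP s Λ c₀ ℓ₀) (hK : UniformContactKornP s Λ c₀ ℓ₀ r₁ cK) (hFS : TailBoundP s Λ c₀ ℓ₀ r₁ ϱ τ γT)
    (hPU : PartitionIdentityFullP s Λ c₀ ℓ₀ r₁ ϱ R) (hJC : ClusterCertificateFullP s Λ c₀ ℓ₀ r₁ ϱ R cK τ κ₁)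
    (hCZ : IndexCurrencyP s Λ c₀ ℓ₀ r₁ cZ) : UniformEquilStabilityAt s Λ κ₀ c₀ :=
  uniformEquilStabilityAt_of_clusterCertificateFull h0 hκ hRI hK nullLagrangianP hFS hPU hJC hCZ

/-- RECORD INSTANCE of D⁗ (GO edition 2 constants) with (NL♯) no longer a hypothesis: (U♯) at `(1/50, 2)` with `κ₀ = cZ/40` from
(RI♯), (K♯)(1/10), (TL♯)(ϱ = 7/2, τ = 1/50, γT = 0), (PF♯)(R = 3), (JF♯)(cK = 1/10, τ = 1/50, κ₁ = 1/40), (CZ♯). [g98] -/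
example {c₀ cZ : ℝ} (hRI : UniformReindexP (1 / 50) 2 c₀ 3) (hK : UniformContactKornP (1 / 50) 2 c₀ 3 (9 / 8) (1 / 10))
    (hFS : TailBoundP (1 / 50) 2 c₀ 3 (9 / 8) (7 / 2) (1 / 50) 0) (hPU : PartitionIdentityFullP (1 / 50) 2 c₀ 3 (9 / 8) (7 / 2) 3)
    (hJC : ClusterCertificateFullP (1 / 50) 2 c₀ 3 (9 / 8) (7 / 2) 3 (1 / 10) (1 / 50) (1 / 40))
    (hCZ : IndexCurrencyP (1 / 50) 2 c₀ 3 (9 / 8) cZ) : UniformEquilStabilityAt (1 / 50) 2 (cZ / 40) c₀ :=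
  uniformEquilStabilityAt_of_clusterCertificateFull' (κ₁ := 1 / 40) (γT := 0) (by norm_num) (by ring_nf; rfl) hRI hK hFS hPU hJC hCZ

end Summit.AtomisticToContinuum.Crystallization.Theorems.ChartedZeroExcessLayeredLatticeLiouville
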